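import Literature.Analysis.Complex.RootsOfUnityComplementLocalRootSystems
import HarnessLib

/-!
# CDT Proposition 3.0.1, algebraization: the case of a `G`-invariant function (subgroup form)

`Literature/Analysis/Complex/RootsOfUnityComplementInvariantSubgroup.lean` — PROOF-ONLY (no definition,
no named fact). Sequel of `RootsOfUnityComplementLocalRootSystems.lean`: the finset of conjugates required
there is produced from a SUBGROUP `G ≤ SL(2, ℤ)` of finite index containing every conjugate of `T^{2N}`
("cusp widths dividing `2N` at all cusps", CDT Definition 4.1.1/4.2.1) under which `h` is invariant: the
conjugates are `h(t • ·)` for `t⁻¹` running over representatives of the (finitely many) left cosets of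
`G ∩ Λ_N` in the deck group `Λ_N` of the uniformizer. F. Calegari, V. Dimitrov, Y. Tang, J. Amer. Math.
Soc. 38 (2025), proof of Proposition 3.0.1 / Remark 3.0.2.

★ `exists_taylor_subst_eq_of_invariant_subgroup` — for the universal covering `Φ = F_N`, a holomorphic
`h : ℍ → ℂ` invariant under such a `G` and bounded at `i∞` after every element of `Λ_N` (i.e. at all
cusps above `λ = 0`; achieved by the `λᵏ`-twist), and `f ∈ ℚ⟦x⟧` with `f(x(t)) = 𝓣(cuspFunction (2N) h)`:
the hypothesis-(iii) datum `han` of `CalegariDimitrovTang2025_unboundedDenominators.dim_le_unconditional`.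

## References
* [CalegariDimitrovTang2025] F. Calegari, V. Dimitrov, Y. Tang, J. Amer. Math. Soc. 38 (2025), proof of
  Proposition 3.0.1 and Remark 3.0.2; Definition 4.2.1.
-/

noncomputable section

open Complex Real Filter Topology Function Metric Set
open UpperHalfPlane hiding I
open scoped Real Topology Manifold MatrixGroups

namespace Literature.Analysis.Complex

open _root_.Complex Literature.NumberTheory.Automorphic Literature.NumberTheory.Automorphic.ModularLambda
  ModularGroup

/-- ★ **Hypothesis (iii) of CDT Theorem 2.0.1 for a `G`-invariant holomorphic function** (`G` of finite
index containing all conjugates of `T^{2N}`, `h` bounded at the cusps above `λ = 0`). See the module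
docstring. [cite: CalegariDimitrovTang2025, Proposition 3.0.1 (proof) and Remark 3.0.2] -/
theorem exists_taylor_subst_eq_of_invariant_subgroup {N : ℕ} (hN : 0 < N) {Φ : ℂ → ℂ}
    (hΦ : DifferentiableOn ℂ Φ (ball (0 : ℂ) 1)) (hΦU : MapsTo Φ (ball (0 : ℂ) 1) {z : ℂ | z ^ N ≠ 1})
    (hcov : IsCoveringMap hΦU.restrict) (hΦ0 : Φ 0 = 0)
    {G : Subgroup SL(2, ℤ)} [G.FiniteIndex]
    (hconj : ∀ g : SL(2, ℤ), g * T ^ (2 * N) * g⁻¹ ∈ G)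
    {h : ℍ → ℂ} (hh : MDiff h) (hinv : ∀ g ∈ G, ∀ τ : ℍ, h (g • τ) = h τ)
    (hbdd : ∀ γ ∈ modularLambdaRootDeck N, IsBoundedAtImInfty (fun τ : ℍ ↦ h (γ • τ)))
    {L : PowerSeries ℤ} (hL : qExpansion 2 (fun τ : ℍ ↦ modularLambda τ / 16) = L.map (Int.castRingHom ℂ))
    {x : PowerSeries ℚ} (hx0 : PowerSeries.constantCoeff x = 0) (hx1 : PowerSeries.coeff 1 x = 1)
    (hxN : x ^ N = PowerSeries.expand N hN.ne' (L.map (Int.castRingHom ℚ)))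
    {f : PowerSeries ℚ}
    (hfH : (f.map (algebraMap ℚ ℂ)).subst (x.map (algebraMap ℚ ℂ)) =
      PowerSeries.mk fun n ↦ iteratedDeriv n (cuspFunction ((2 * N : ℕ) : ℝ) h) 0 / n.factorial)
    {r : ℝ} (hr0 : 0 < r) (hr1 : r < 1) :
    ∃ g : ℂ → ℂ, AnalyticOnNhd ℂ g (closedBall 0 1) ∧
      (f.map (algebraMap ℚ ℂ)).subst (PowerSeries.mk fun n ↦
          iteratedDeriv n (fun z : ℂ ↦ (((16 : ℝ) ^ (-(N : ℝ)⁻¹) : ℝ) : ℂ) * Φ ((r : ℂ) * z)) 0 /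
            n.factorial) =
        PowerSeries.mk fun n ↦ iteratedDeriv n g 0 / n.factorial := by
  classical
  set Λ : Subgroup SL(2, ℤ) := modularLambdaRootDeck N with hΛ
  -- the left cosets of `G ∩ Λ` in `Λ` and representatives, with `1` representing the identity coset
  set G' : Subgroup Λ := G.subgroupOf Λ with hG'
  haveI : G'.FiniteIndex := Subgroup.instFiniteIndex_subgroupOf G Λ
  haveI : Fintype (Λ ⧸ G') := Fintype.ofFinite _
  set rep : Λ ⧸ G' → Λ := fun q ↦ if q = (QuotientGroup.mk 1) then 1 else q.out with hrep
  have hrep_mk : ∀ q, (QuotientGroup.mk (rep q) : Λ ⧸ G') = q := by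
    intro q
    simp only [hrep]
    split_ifs with hq
    · rw [hq]
    · exact QuotientGroup.out_eq' q
  -- the conjugates `t q := (rep q)⁻¹`
  set t : Λ ⧸ G' → SL(2, ℤ) := fun q ↦ ((rep q : Λ) : SL(2, ℤ))⁻¹ with ht
  have ht_mem : ∀ q, t q ∈ Λ := fun q ↦ Λ.inv_mem (rep q).2
  have ht_inj : Function.Injective t := by
    intro q₁ q₂ h12
    have : rep q₁ = rep q₂ := Subtype.ext (inv_injective h12)
    rw [← hrep_mk q₁, ← hrep_mk q₂, this]
  set Tset : Finset SL(2, ℤ) := Finset.univ.map ⟨t, ht_inj⟩ with hTset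
  have hTval : Tset.val = Finset.univ.val.map t := by rw [hTset, Finset.map_val]; rfl
  have h1T : (1 : SL(2, ℤ)) ∈ Tset := by
    rw [hTset, Finset.mem_map]
    refine ⟨QuotientGroup.mk 1, Finset.mem_univ _, ?_⟩
    simp [ht, hrep]
  -- invariance bookkeeping: `h ((g * s) • τ) = h (s • τ)` for `g ∈ G`
  have hinv' : ∀ g ∈ G, ∀ (s : SL(2, ℤ)) (τ : ℍ), h ((g * s) • τ) = h (s • τ) := by
    intro g hg s τ; rw [mul_smul, hinv g hg]
  -- hperm
  have hperm : ∀ κ ∈ Λ, Tset.val.map (fun s ↦ fun τ : ℍ ↦ h ((s * κ) • τ)) =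
      Tset.val.map (fun s ↦ fun τ : ℍ ↦ h (s • τ)) := by
    intro κ hκ
    set κ' : Λ := ⟨κ, hκ⟩ with hκ'
    -- the permutation `q ↦ κ⁻¹ • q` of the coset space
    set σ : Λ ⧸ G' ≃ Λ ⧸ G' := MulAction.toPerm (κ'⁻¹) with hσ
    have key : ∀ q, (fun τ : ℍ ↦ h ((t q * κ) • τ)) = fun τ : ℍ ↦ h (t (σ q) • τ) := by
      intro q
      -- `rep (σ q) = κ⁻¹ * rep q * g` with `g ∈ G'`
      have hq : (QuotientGroup.mk (κ'⁻¹ * rep q) : Λ ⧸ G') = σ q := by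
        rw [hσ, MulAction.toPerm_apply, ← hrep_mk q, MulAction.Quotient.smul_mk, smul_eq_mul, hrep_mk q]
      have hq' : (QuotientGroup.mk (κ'⁻¹ * rep q) : Λ ⧸ G') = QuotientGroup.mk (rep (σ q)) := by
        rw [hq, hrep_mk]
      rw [QuotientGroup.eq] at hq'
      -- `(κ⁻¹ rep q)⁻¹ * rep (σ q) ∈ G'`, i.e. `g := (rep q)⁻¹ κ rep(σ q) ∈ G`
      have hgG : (((κ'⁻¹ * rep q)⁻¹ * rep (σ q) : Λ) : SL(2, ℤ)) ∈ G := Subgroup.mem_subgroupOf.mp hq'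
      funext τ
      -- `t q * κ = (rep q)⁻¹ κ = g * (rep (σ q))⁻¹ = g * t (σ q)` with the above `g`
      have e1 : t q * κ = (((κ'⁻¹ * rep q)⁻¹ * rep (σ q) : Λ) : SL(2, ℤ)) * t (σ q) := by
        simp only [ht, hκ', Subgroup.coe_mul, Subgroup.coe_inv, mul_inv_rev, inv_inv]
        group
      rw [e1, hinv' _ hgG]
    rw [hTval, Multiset.map_map, Multiset.map_map]
    have e2 : ((fun s ↦ fun τ : ℍ ↦ h ((s * κ) • τ)) ∘ t) = ((fun s ↦ fun τ : ℍ ↦ h (s • τ)) ∘ t) ∘ σ := by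
      funext q; exact key q
    rw [e2, ← Multiset.map_map _ σ, Multiset.map_univ_val_equiv]
  -- hper and hbdd on the conjugates
  have hper : ∀ s ∈ Tset, ∀ τ : ℍ, h (s • ((((2 * N : ℕ) : ℝ)) +ᵥ τ)) = h (s • τ) := by
    intro s _ τ
    have e1 : (((2 * N : ℕ) : ℝ)) +ᵥ τ = (T ^ (2 * N) : SL(2, ℤ)) • τ := by
      rw [← zpow_natCast, modular_T_zpow_smul]; push_cast; rfl
    rw [e1, ← mul_smul, show s * T ^ (2 * N) = (s * T ^ (2 * N) * s⁻¹) * s by group, hinv' _ (hconj s)]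
  have hbddT : ∀ s ∈ Tset, IsBoundedAtImInfty (fun τ : ℍ ↦ h (s • τ)) := by
    intro s hs
    rw [hTset, Finset.mem_map] at hs
    obtain ⟨q, -, rfl⟩ := hs
    exact hbdd _ (ht_mem q)
  exact exists_taylor_subst_eq_of_invariant hN hΦ hΦU hcov hΦ0 hh h1T hperm hper hbddT hL hx0 hx1 hxN
    hfH hr0 hr1

end Literature.Analysis.Complex

end
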